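import Literature.Probability.RandomPlanarGeometry.ChordalCurveFamily
import Literature.Probability.LatticeModels.DobrushinDiscretisation

/-!
# Drefute note (Lean part): orientation reversal of a Dobrushin domain and the hidden
# arc-swap obligation inside STUBS 6–7 of line `crosscut-dictionary` (crux `LagHandOff`)

Refuter `drefute` (`refuter-drefute-stmt-CriticalPhenomena-10268-0`), companion of
`Negative-notes/FreeAxioms.md`.  Restores to the tree the orientation-reversal construction of
cdisprove g2 (`reverseDobrushin`; lost — it never reached the tree path, see `Disproof.lean`
§Cycle 3, provenance note) and records as theorems:

* `reverse D` — the SAME carrier with the SAME marked points `a = D.pt 0`, `b = D.pt 1`, the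
  boundary loop run backwards (`carrier_reverse`, `pt_reverse_zero`, `pt_reverse_one`);
  `arc_reverse_zero : (reverse D).arc 0 = D.arc 1`, `arc_reverse_one : (reverse D).arc 1 = D.arc 0`
  — the two boundary arcs are SWAPPED.
* `eq_of_isLocal`, `eq_of_isDomainMarkov` — each of the two axioms concluded by
  `stub_freeAxioms` (its `IsLocal` conjunct; `stopAt ∅ = id`, as in `Disproof.lean`
  `eq_of_isLocal_of_carrier_eq`) and by `stub_markovPassage` (`IsDomainMarkov`, through
  `IsMarkovExtension.initial` + `.domain`) forces ON ITS OWN `P (reverse D) = P D`.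
* `tendsto_arcA_of_reverse` — a `ℤ²`-discretisation family of `reverse D` has its WIRED data
  arc converging to `D.arc 1 = (ba)`: `HandsOff` (line file) therefore pins
  `lawFamily Ψ μ (reverse D)` to the subsequential limit of bond-`ℤ²` interfaces with the wiring
  SWAPPED (`(ba)` open, `(ab)` dual-wired), and `lawFamily Ψ μ D` to the `(ab)`-wired limit
  (`bondInterfaceIn` reads `D` only through `D.pt 0`, `D.pt 1`, which `reverse` preserves).

So STUB 6 and STUB 7 each contain the obligation "swapped-wiring interface laws of every
Dobrushin domain have the same limit along every quad-convergent mesh sequence".  On bond-`ℤ²`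
the mechanism is self-duality, which lands on the DUAL lattice `δℤ² + δ(1+i)/2`, i.e. on the
interfaces of the translated domain `D - δ(1+i)/2` drawn on `δℤ²`, which
`IsCrosscutDictionary.handsOff` (lattice `δℤ²` only; `Ω_eq : (E δ).Ω = D.carrier` exactly) does
not cover — see the `.md` note for the two proposed repairs.  Nothing here refutes a stub.
-/

noncomputable section

open Set MeasureTheory Filter Topology

namespace Summit.CriticalPhenomena.CardyFormulaZ2.Cruxes.LagHandOff.Drefute

open Literature.Probability.RandomPlanarGeometry Literature.Probability.LatticeModels

/-! ### Periodicity bookkeeping for the boundary loop -/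

/-- The boundary loop only sees the fractional part of the parameter. -/
theorem boundary_fract (D : JordanDomain) (s : ℝ) : D.boundary (Int.fract s) = D.boundary s := by
  rw [← Int.self_sub_floor]
  simpa using D.periodic_boundary.sub_int_mul_eq ⌊s⌋ (x := s)

/-- Injectivity of the boundary loop modulo the period: equal boundary points have parameters
differing by an integer. -/
theorem exists_int_of_boundary_eq (D : JordanDomain) {s t : ℝ} (h : D.boundary s = D.boundary t) :
    ∃ z : ℤ, s - t = z := by
  rw [← boundary_fract D s, ← boundary_fract D t] at h
  have hs : Int.fract s ∈ Ico (0 : ℝ) 1 := ⟨Int.fract_nonneg s, Int.fract_lt_one s⟩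
  have ht : Int.fract t ∈ Ico (0 : ℝ) 1 := ⟨Int.fract_nonneg t, Int.fract_lt_one t⟩
  exact Int.fract_eq_fract.1 (D.injOn_boundary hs ht h)

/-- Shifting a parameter interval by the period does not change its image on the boundary. -/
theorem image_boundary_Icc_add_one (D : JordanDomain) (u v : ℝ) :
    D.boundary '' Icc u v = D.boundary '' Icc (u + 1) (v + 1) := by
  rw [← image_add_const_Icc, image_image]
  exact image_congr fun x _ => (D.periodic_boundary x).symm

/-! ### Orientation reversal -/

/-- **Orientation reversal** of a Dobrushin domain: the same carrier, the boundary loop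
`t ↦ ∂D (mark 0 - t)` run backwards from `a`, marks `0` (at `a`) and `1 + mark 0 - mark 1`
(at `b`).  Same `a`, `b`; the arcs `(ab)` and `(ba)` are exchanged (`arc_reverse_zero/one`). -/
def reverse (D : DobrushinDomain) : DobrushinDomain where
  carrier := D.carrier
  boundary := fun t => D.boundary (D.mark 0 - t)
  isOpen := D.isOpen
  isBounded := D.isBounded
  isConnected := D.isConnected
  continuous_boundary := D.continuous_boundary.comp (continuous_const.sub continuous_id)
  periodic_boundary := fun t => by
    show D.boundary (D.mark 0 - (t + 1)) = D.boundary (D.mark 0 - t)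
    rw [show D.mark 0 - (t + 1) = (D.mark 0 - t) - 1 by ring]
    exact D.periodic_boundary.sub_eq (D.mark 0 - t)
  injOn_boundary := by
    intro s hs t ht h
    obtain ⟨z, hz⟩ := exists_int_of_boundary_eq D.toJordanDomain h
    have h1 : (-1 : ℝ) < ((z : ℤ) : ℝ) := by linarith [hs.1, hs.2, ht.1, ht.2]
    have h2 : ((z : ℤ) : ℝ) < 1 := by linarith [hs.1, hs.2, ht.1, ht.2]
    have hz1 : (-1 : ℤ) < z := by exact_mod_cast h1
    have hz2 : z < 1 := by exact_mod_cast h2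
    have hz0 : z = 0 := by omega
    rw [hz0, Int.cast_zero] at hz
    linarith
  range_boundary := by
    have hsurj : Function.Surjective fun t : ℝ => D.mark 0 - t :=
      fun y => ⟨D.mark 0 - y, sub_sub_cancel _ _⟩
    rw [show (fun t => D.boundary (D.mark 0 - t)) = D.boundary ∘ fun t => D.mark 0 - t from rfl,
      hsurj.range_comp]
    exact D.range_boundary
  mark := ![0, 1 + D.mark 0 - D.mark 1]
  strictMono_mark := by
    have h01 : D.mark 0 < D.mark 1 := D.strictMono_mark (show (0 : Fin 2) < 1 by decide)
    have h1 : D.mark 1 < 1 := (D.mark_mem 1).2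
    have h0 : 0 ≤ D.mark 0 := (D.mark_mem 0).1
    refine Fin.strictMono_iff_lt_succ.2 fun k => ?_
    fin_cases k
    show (0 : ℝ) < 1 + D.mark 0 - D.mark 1
    linarith
  mark_mem := by
    have h01 : D.mark 0 < D.mark 1 := D.strictMono_mark (show (0 : Fin 2) < 1 by decide)
    have h0 : 0 ≤ D.mark 0 := (D.mark_mem 0).1
    have h1 : D.mark 1 < 1 := (D.mark_mem 1).2
    intro k
    fin_cases k
    · exact ⟨le_rfl, zero_lt_one⟩
    · show 1 + D.mark 0 - D.mark 1 ∈ Ico (0 : ℝ) 1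
      exact ⟨by linarith, by linarith⟩

variable (D : DobrushinDomain)

/-- Same carrier. -/
@[simp] theorem carrier_reverse : (reverse D).carrier = D.carrier := rfl

/-- Same boundary loop, reversed. -/
@[simp] theorem boundary_reverse (t : ℝ) : (reverse D).boundary t = D.boundary (D.mark 0 - t) := rfl

@[simp] theorem mark_reverse_zero : (reverse D).mark 0 = 0 := rfl

@[simp] theorem mark_reverse_one : (reverse D).mark 1 = 1 + D.mark 0 - D.mark 1 := rfl

/-- Same first marked point `a`. -/
@[simp] theorem pt_reverse_zero : (reverse D).pt 0 = D.pt 0 := by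
  simp [MarkedDomain.pt]

/-- Same second marked point `b`. -/
@[simp] theorem pt_reverse_one : (reverse D).pt 1 = D.pt 1 := by
  simp only [MarkedDomain.pt, boundary_reverse, mark_reverse_one]
  rw [show D.mark 0 - (1 + D.mark 0 - D.mark 1) = D.mark 1 - 1 by ring]
  exact D.periodic_boundary.sub_eq (D.mark 1)

theorem nextMark_zero (G : DobrushinDomain) : G.nextMark 0 = G.mark 1 := by
  unfold MarkedDomain.nextMark
  rw [dif_pos (by decide)]
  exact congrArg G.mark (Fin.ext (by simp))

theorem nextMark_one (G : DobrushinDomain) : G.nextMark 1 = G.mark 0 + 1 := by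
  unfold MarkedDomain.nextMark
  rw [dif_neg (by decide)]
  exact congrArg (fun i : Fin 2 => G.mark i + 1) (Fin.ext (by simp))

/-- **The arcs are swapped, I**: the arc `(ab)` of the reversed domain is the arc `(ba)` of `D`. -/
theorem arc_reverse_zero : (reverse D).arc 0 = D.arc 1 := by
  simp only [MarkedDomain.arc, nextMark_zero, nextMark_one, mark_reverse_zero, mark_reverse_one]
  rw [show (reverse D).boundary = fun t => D.boundary (D.mark 0 - t) from rfl,
    ← image_image D.boundary (fun t => D.mark 0 - t), image_const_sub_Icc,
    image_boundary_Icc_add_one D.toJordanDomain (D.mark 0 - (1 + D.mark 0 - D.mark 1)) (D.mark 0 - 0)]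
  congr 2 <;> ring

/-- **The arcs are swapped, II**: the arc `(ba)` of the reversed domain is the arc `(ab)` of `D`. -/
theorem arc_reverse_one : (reverse D).arc 1 = D.arc 0 := by
  simp only [MarkedDomain.arc, nextMark_zero, nextMark_one, mark_reverse_zero, mark_reverse_one]
  rw [show (reverse D).boundary = fun t => D.boundary (D.mark 0 - t) from rfl,
    ← image_image D.boundary (fun t => D.mark 0 - t), image_const_sub_Icc,
    image_boundary_Icc_add_one D.toJordanDomain (D.mark 0 - (0 + 1))
      (D.mark 0 - (1 + D.mark 0 - D.mark 1))]
  congr 2 <;> ring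

/-! ### Each of `IsLocal`, `IsDomainMarkov` alone forces wiring-orientation blindness -/

/-- Stopping at the empty set stops nothing (curve level). -/
theorem Curve.stopAt_empty (c : Curve ℂ) : c.stopAt (∅ : Set ℂ) = c := by
  have hparam : c.hitParam (∅ : Set ℂ) = 1 := by
    apply le_antisymm (c.hitParam_mem_Icc ∅).2
    apply le_csInf ⟨1, c.one_mem_hitSet ∅⟩
    rintro t (⟨_h, ht⟩ | ht)
    · exact absurd ht (Set.notMem_empty _)
    · rw [Set.mem_singleton_iff.1 ht]
  refine Curve.ext (ContinuousMap.ext fun s => ?_)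
  change (c.stopAt ∅) s = c s
  rw [Curve.stopAt_apply, hparam, one_mul, Set.projIcc_val]

/-- Stopping at the empty set stops nothing (curve-class level). -/
theorem CurveClass.stopAt_empty (γ : CurveClass ℂ) : γ.stopAt (∅ : Set ℂ) = γ := by
  change CurveClass.mk (γ.out.stopAt ∅) = γ
  rw [Curve.stopAt_empty, CurveClass.mk_out]

/-- **`IsLocal` alone ⇒ `P (reverse D) = P D`** (`D' := reverse D ⊆ D`, same marked points,
stopping set `closure (D ∖ D) = ∅`).  Cf. `Disproof.lean`, `eq_of_isLocal_of_carrier_eq`. -/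
theorem eq_of_isLocal {P : ChordalFamily} (hP : P.IsLocal) (D : DobrushinDomain) :
    P (reverse D) = P D := by
  have hempty : closure (D.carrier \ (reverse D).carrier) = ∅ := by
    rw [carrier_reverse, sdiff_self]; exact closure_empty
  have hpre : ∀ T : Set (CurveClass ℂ), CurveClass.stopAt (∅ : Set ℂ) ⁻¹' T = T := by
    intro T; ext γ; simp [CurveClass.stopAt_empty]
  ext T hT
  have h := hP D (reverse D) (carrier_reverse D).le (pt_reverse_zero D) (pt_reverse_one D) T hT
  rw [hempty, hpre] at h
  exact h

/-- The remaining domain only reads the carrier and the target point. -/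
theorem remainingDomain_reverse (past : CurveClass ℂ) :
    remainingDomain (reverse D) past = remainingDomain D past := by
  simp only [remainingDomain, carrier_reverse, pt_reverse_one]

/-- **`IsDomainMarkov` alone ⇒ `P (reverse D) = P D`**: by `initial`, `P G = Q G (const a)`,
and by `domain` the kernel `Q G past` reads `G` only through `(remainingDomain G past, D.pt 1)`,
which `reverse` preserves. -/
theorem eq_of_isDomainMarkov {P : ChordalFamily} (hP : P.IsDomainMarkov) (D : DobrushinDomain) :
    P (reverse D) = P D := by
  obtain ⟨Q, hQ⟩ := hP
  rw [← hQ.initial (reverse D), ← hQ.initial D, pt_reverse_zero]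
  exact hQ.domain (reverse D) D _ _ (remainingDomain_reverse D _) rfl (pt_reverse_one D)

/-- Hence so does the bundle `IsLocalMarkovChordalFamily` (twice over). -/
theorem eq_of_isLocalMarkovChordalFamily {P : ChordalFamily} (hP : IsLocalMarkovChordalFamily P)
    (D : DobrushinDomain) : P (reverse D) = P D :=
  eq_of_isLocal hP.isLocal D

/-! ### What `HandsOff` pins for the reversed domain: the wiring is swapped -/

/-- A `ℤ²`-discretisation family of `reverse D` has its WIRED data arcs `arcA` converging to
`(ba) = D.arc 1` and its dual-wired arcs `arcB` to `(ab) = D.arc 0` (the opposite of a family of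
`D`), with the same carrier, mesh, marked points and admissibility clauses.  Since
`bondInterfaceIn G (E δ)` reads `G` only through `G.pt 0`, `G.pt 1` (orientation of the polyline),
the interfaces it feeds to `HandsOff` for `reverse D` are the bond-`ℤ²` explorations of the
carrier of `D` from `a` to `b` WITH THE WIRED ARC SWAPPED. -/
theorem tendsto_arcs_of_reverse {E : ℝ → DiscreteDobrushin}
    (h : ZdDiscretisationFamily (reverse D) E) :
    Tendsto (fun δ => Metric.hausdorffEDist (E δ).arcA (D.arc 1)) (𝓝[>] 0) (𝓝 0) ∧
      Tendsto (fun δ => Metric.hausdorffEDist (E δ).arcB (D.arc 0)) (𝓝[>] 0) (𝓝 0) ∧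
      (∀ δ, (E δ).Ω = D.carrier) ∧
      Tendsto (fun δ => Metric.hausdorffEDist (medialPoint δ '' (E δ).zdABEdges) {D.pt 0, D.pt 1})
        (𝓝[>] 0) (𝓝 0) := by
  refine ⟨?_, ?_, fun δ => h.Ω_eq δ, ?_⟩
  · simpa only [arc_reverse_zero] using h.tendsto_arcA
  · simpa only [arc_reverse_one] using h.tendsto_arcB
  · simpa only [pt_reverse_zero, pt_reverse_one] using h.tendsto_zdABEdges

/-- Conversely, swapping the two data arcs of a `ℤ²`-discretisation family of `D` gives a
`ℤ²`-discretisation family of `reverse D` (admissibility is symmetric in the two arcs). -/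
theorem zdDiscretisationFamily_reverse_swap {E : ℝ → DiscreteDobrushin}
    (h : ZdDiscretisationFamily D E) :
    ZdDiscretisationFamily (reverse D) (fun δ => ⟨(E δ).Ω, (E δ).δ, (E δ).arcB, (E δ).arcA⟩) := by
  -- the swapped data have the same square-lattice boundary; their discrete arcs are exchanged
  have hA : ∀ δ, DiscreteDobrushin.zdArcA ⟨(E δ).Ω, (E δ).δ, (E δ).arcB, (E δ).arcA⟩ = (E δ).zdArcB :=
    fun δ => rfl
  have hB : ∀ δ, DiscreteDobrushin.zdArcB ⟨(E δ).Ω, (E δ).δ, (E δ).arcB, (E δ).arcA⟩ = (E δ).zdArcA :=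
    fun δ => rfl
  have hbd : ∀ δ, DiscreteDobrushin.zdBoundary ⟨(E δ).Ω, (E δ).δ, (E δ).arcB, (E δ).arcA⟩ =
      (E δ).zdBoundary := fun δ => rfl
  have hAB : ∀ δ, DiscreteDobrushin.zdABEdges ⟨(E δ).Ω, (E δ).δ, (E δ).arcB, (E δ).arcA⟩ =
      (E δ).zdABEdges := by
    intro δ
    ext e
    simp only [DiscreteDobrushin.mem_zdABEdges_iff, hA, hB]
    constructor
    · rintro ⟨he, hx, hy⟩; exact ⟨he, hy, hx⟩
    · rintro ⟨he, hx, hy⟩; exact ⟨he, hy, hx⟩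
  have hinner : ∀ δ f, DiscreteDobrushin.IsInnerFace ⟨(E δ).Ω, (E δ).δ, (E δ).arcB, (E δ).arcA⟩ f ↔
      (E δ).IsInnerFace f := fun δ f => Iff.rfl
  refine
    { Ω_eq := fun δ => h.Ω_eq δ
      δ_eq := fun δ => h.δ_eq δ
      tendsto_arcA := by simpa only [arc_reverse_zero] using h.tendsto_arcB
      tendsto_arcB := by simpa only [arc_reverse_one] using h.tendsto_arcA
      tendsto_zdABEdges := by
        simpa only [hAB, pt_reverse_zero, pt_reverse_one] using h.tendsto_zdABEdges
      eventually_isZdAdmissible := ?_ }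
  filter_upwards [h.eventually_isZdAdmissible] with δ hadm
  exact
    { isBounded := hadm.isBounded
      delta_pos := hadm.delta_pos
      zdArcA_nonempty := by rw [hA]; exact hadm.zdArcB_nonempty
      zdArcB_nonempty := by rw [hB]; exact hadm.zdArcA_nonempty
      disjoint := by rw [hA, hB]; exact hadm.disjoint.symm
      zdBoundary_subset := by
        rw [hA, hB, hbd, Set.union_comm]; exact hadm.zdBoundary_subset
      ncard_zdABEdges_eq_two := by rw [hAB]; exact hadm.ncard_zdABEdges_eq_two
      zdABEdges_inner := by
        intro e he
        rw [hAB] at he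
        simpa only [hinner] using hadm.zdABEdges_inner e he }

end Summit.CriticalPhenomena.CardyFormulaZ2.Cruxes.LagHandOff.Drefute

end
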